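import Literature.NumberTheory.EllipticCurves.GreenbergSelmer
import Literature.NumberTheory.GaloisRepresentations.AbsGaloisGroupCompact
import Literature.NumberTheory.GaloisRepresentations.LocalHOneInertiaRestrictionProfinite
import Literature.NumberTheory.GaloisRepresentations.LocalGaloisGroupFrobeniusProofs
import Literature.NumberTheory.EllipticCurves.ZpExtension
import Mathlib.Topology.Algebra.ClopenNhdofOne
import HarnessLib

/-!
# (α3) KERNEL DESCENT V — ROW 1, the LOCAL half as PROFINITE GROUP THEORY: the unramified quotient
# `(H ⊓ D_v)/(H ⊓ I_v)` is pro-prime-to-`p` as soon as `H ≤ ker κ` for a `ℤ_p`-character `κ` of `D_v` that is UNRAMIFIED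
# (`κ(I_v) = 1`) and NON-TRIVIAL on `D_v` — i.e. the displayed hypothesis (hp′) of part IV, discharged from
# «`K̃_{∞,w} ⊇` an unramified `ℤ_p`-extension of `K_v`» with NO class field theory

Cell `bsd-print-cf2`, width seat `bsd-line-cf2c-w8` g7 (prover-bsd-line-cf2c-w8-g7-0), lane **(α3) KERNEL DESCENT**, planner brief
`Cruxes/MainConjClauseAtSplitTwoQuad/JLK-CARRIER-2-BRIEF-plan-g20.md` §1 ROW 1 and -plan g20 2026-08-29T12:57:29Z layer **(a2) LOCAL**: «at a
place `w ∣ 2` of the `ℤ₂²`-tower `K̃_∞` of `K` with `2` SPLIT, the completion contains the unramified `ℤ₂`-extension of `K_v = ℚ₂`, so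
`Gal(K̃_{∞,w}^{unr}/K̃_{∞,w})` has trivial pro-`2` part — state it with the decomposition hypothesis EXPLICIT». For the DECIDING research child
`PrintCf2RubinValueTwo.MainConjClauseAtSplitTwoQuadDA` (stmt-BirchSwinnertonDyer-24721); `--supports` it `--as helper`, Theses-free. Part IV
(`Theorems/PrintCf2RubinValueTwoJLKDescentUnramifiedStrict`, p720338; not imported here) proved «Greenberg = strict at `v`» MODULO
  (hp′_v) every open subgroup of `H ⊓ D_v` containing `H ⊓ I_v` has index prime to `p`.
THIS FILE PROVES (hp′_v) from two EXPLICIT decomposition hypotheses on ONE `ℤ_p`-extension `κ` of `K` with `H ≤ ker κ`: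
  (U) `I_v ≤ ker κ` (`κ` is unramified at `v`)   and   (N) `∃ τ ∈ D_v, κ τ ≠ 1` (`v` does not split completely in `K̄^{ker κ}`),
by pure profinite group theory on the compact group `D_v` with its closed normal subgroup `I_v` and a Frobenius lift `φ` (`I_v·⟨φ⟩` dense,
tree `dense_absInertia_mul_zpowers_of_isFrobPow` transported along `absGaloisRestrict`). For the crux's DA7 frame (`K = ℚ(√−7)`, `2 = v v̄`,
`κ₁` unramified outside `v`, `κ₂` unramified outside `v̄`, `H = pairKer κ₁ κ₂`): at `v` take `κ = κ₂` ((U) from `IsUnramifiedOutside v̄`, (N) from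
cf2c-w8 g4's `LinePin.exists_mem_decomp_vbar_apply_eq_of_discr` with the roles of `v, v̄` exchanged), at `v̄` take `κ = κ₁` — so ROW 1's
«`unrEverywhere₂ = datumStrictSelmer`» becomes UNCONDITIONAL there (corollary filed separately to keep this file frame-free).

## The argument (Stage 1: `G = ker κ`; Stage 2: closed `G ≤ ker κ`)
Let `D` be a compact Hausdorff totally disconnected group, `I ⊴ D` closed, `φ ∈ D` with `I·⟨φ⟩` dense, `κ : D → ℤ_p` continuous with
`κ(I) = 1 ≠ κ(φ)`, `N = ker κ`. (0) `[D,D] ≤ I` (the commutator set is closed and contains the dense `(I⟨φ⟩)²`-commutators, which die in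
`D/I` because powers of `φ` commute) — so every subgroup `V ⊇ I` is normal with abelian quotient. STAGE 1: if `I ≤ V ≤ N`, `V` open in `N`,
and `p ∣ [N:V]`: put `M_p = {e^p v}` (a closed subgroup ⊇ I ∋ φ^p); density gives `D = ⋃_{k<p} φ^k M_p`; `N ∩ M_p ⊆ N^p V` (if `n = e^p v`
then `κ(e)^p = 1`, so `κ e = 1` as `ℤ_p` is torsion-free); since `p ∣ #(N/V)` the `p`-power map of the finite group `N/V` is not injective
(Cauchy), hence not surjective: some `y ∈ N` lies outside `N^p V ⊇ N ∩ M_p`; then `y ∈ φ^{k} M_p` with `0 < k < p`, Bézout puts `φ` in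
`N·M_p`, so `N·M_p = D` and `κ(D) = κ(M_p) = κ(D)^p`; iterating, `κ(φ) ∈ ⋂ₙ p^n ℤ_p = 0` — contradiction. STAGE 2: for closed `G ≤ N` and
`U ≤ G` open with `G ∩ I ≤ U`, `p ∣ [G:U]`: Cauchy gives `x ∈ G ∖ U` with `x^p ∈ U`; `Ũ = U·I` is closed with `x ∉ Ũ`; a profinite
neighbourhood basis gives an open subgroup `W₀` with `x ∉ Ũ W₀`; `V := N ∩ Ũ W₀` is open in `N`, contains `I`, misses `x` but contains
`x^p` — so `p ∣ [N:V]`, contradicting Stage 1.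

## Contents (this file = Stage 1; Stage 2 and the number-field instance are the sequel `…JLKDescentLocalProPSelmer.lean`)
* `commutator_mem_of_dense_mul_zpowers` (`[D,D] ≤ I`), `normal_of_commutator_le`, `mk_mul_comm_of_commutator_le`, `eq_one_of_pow_prime_eq_one`
  (`ℤ_p` torsion-free), `apply_eq_one_of_forall_exists_pow` (`κ(D) ⊆ κ(D)^p ⟹ κ = 1`), and STAGE 1 **`not_dvd_card_quotient_ker`**: no closed
  `V` with `I ≤ V ≤ ker κ` of finite index in `ker κ` has `p ∣ [ker κ : V]`.

THEOREMS ONLY (no `def`, no named fact, no `sorry`). presearch: Neukirch–Schmidt–Wingberg (7.1.8)(i), (7.5.3) (Frobenius generates `Γ/I`);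
Serre, *Corps locaux* XIII §1; Ribes–Zalesskii, *Profinite Groups* §2.1 (closed subgroups of pro-`𝒞` groups) [corpus]; de Shalit II.1.9.
beyond-print theorem: no. HONEST FRAMING: no class field theory is proved or assumed here beyond the two displayed hypotheses (U), (N); no summit
statement is proved by this seat; BSD is not proved by any of this.

References: Neukirch–Schmidt–Wingberg (2008) (7.1.8), (7.5.3) [NeukirchSchmidtWingberg2008]; J.-P. Serre, *Local Fields* XIII §1
[SerreLocalFields1979]; L. Ribes, P. Zalesskii, *Profinite Groups* (2010) §2.1; E. de Shalit (1987) II.1.9 [deShalit1987].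
-/

noncomputable section

set_option linter.dupNamespace false -- D-0017: single-problem summit, `…BirchSwinnertonDyer.BirchSwinnertonDyer…` repeats a namespace by design
set_option autoImplicit false

open scoped Classical Pointwise

namespace Summit.BirchSwinnertonDyer.BirchSwinnertonDyer.Theorems.PrintCf2.JLKDescent

open Literature.NumberTheory.EllipticCurves Literature.NumberTheory.GaloisRepresentations

universe u

/-! ## §1. Profinite group theory: `ker κ` and its closed subgroups are pro-prime-to-`p` modulo `I` -/

section ProP

variable {D : Type u} [Group D] [TopologicalSpace D] [IsTopologicalGroup D] [CompactSpace D] [T2Space D]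
  {p : ℕ} [hp : Fact p.Prime]

omit [CompactSpace D] [T2Space D] hp in
/-- **Commutators die in `I` when `I·⟨φ⟩` is dense**: for a closed normal subgroup `I` and `φ ∈ D` with `I * zpowers φ` dense,
`x y x⁻¹ y⁻¹ ∈ I` for all `x, y ∈ D` (the commutator condition is closed and holds on the dense set, where both elements are powers of
`φ` modulo `I`). [cite: NeukirchSchmidtWingberg2008, (7.5.3)] -/
theorem commutator_mem_of_dense_mul_zpowers (I : Subgroup D) [I.Normal] (hI : IsClosed (I : Set D)) (φ : D)
    (hdense : Dense ((I : Set D) * (Subgroup.zpowers φ : Set D))) (x y : D) : x * y * x⁻¹ * y⁻¹ ∈ I := by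
  let S : Set (D × D) := {q | q.1 * q.2 * q.1⁻¹ * q.2⁻¹ ∈ I}
  have hS : IsClosed S := hI.preimage (by fun_prop)
  have hsub : ((I : Set D) * (Subgroup.zpowers φ : Set D)) ×ˢ ((I : Set D) * (Subgroup.zpowers φ : Set D)) ⊆ S := by
    rintro ⟨a, b⟩ ⟨⟨i, hi, z, hz, rfl⟩, ⟨j, hj, w, hw, rfl⟩⟩
    change (i * z) * (j * w) * (i * z)⁻¹ * (j * w)⁻¹ ∈ I
    rw [← QuotientGroup.eq_one_iff]
    have hi1 : (i : D ⧸ I) = 1 := (QuotientGroup.eq_one_iff i).mpr hi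
    have hj1 : (j : D ⧸ I) = 1 := (QuotientGroup.eq_one_iff j).mpr hj
    obtain ⟨m, rfl⟩ := Subgroup.mem_zpowers_iff.mp hz
    obtain ⟨n, rfl⟩ := Subgroup.mem_zpowers_iff.mp hw
    have hc : Commute ((φ : D ⧸ I) ^ m) ((φ : D ⧸ I) ^ n) := (Commute.refl _).zpow_zpow m n
    simp only [QuotientGroup.mk_mul, QuotientGroup.mk_inv, QuotientGroup.mk_zpow, hi1, hj1, one_mul]
    rw [hc.eq]
    group
  have hdense2 := hdense.prod hdense
  have hall : S = Set.univ := by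
    refine Set.eq_univ_of_univ_subset ?_
    rw [← hdense2.closure_eq]
    exact hS.closure_subset_iff.mpr hsub
  have : (x, y) ∈ S := by rw [hall]; exact Set.mem_univ _
  exact this

omit [TopologicalSpace D] [IsTopologicalGroup D] [CompactSpace D] [T2Space D] hp in
/-- A subgroup containing all commutators is normal. [folklore] -/
theorem normal_of_commutator_le {I V : Subgroup D} (hcomm : ∀ x y : D, x * y * x⁻¹ * y⁻¹ ∈ I) (hIV : I ≤ V) : V.Normal :=
  ⟨fun v hv g ↦ by
    have h : g * v * g⁻¹ = (g * v * g⁻¹ * v⁻¹) * v := by group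
    rw [h]
    exact V.mul_mem (hIV (hcomm g v)) hv⟩

omit [TopologicalSpace D] [IsTopologicalGroup D] [CompactSpace D] [T2Space D] hp in
/-- Modulo a subgroup `V` containing all commutators, the quotient group is commutative. [folklore] -/
theorem mk_mul_comm_of_commutator_le {I V : Subgroup D} [V.Normal] (hcomm : ∀ x y : D, x * y * x⁻¹ * y⁻¹ ∈ I) (hIV : I ≤ V)
    (a b : D ⧸ V) : a * b = b * a := by
  obtain ⟨x, rfl⟩ := QuotientGroup.mk_surjective a
  obtain ⟨y, rfl⟩ := QuotientGroup.mk_surjective b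
  rw [← QuotientGroup.mk_mul, ← QuotientGroup.mk_mul, QuotientGroup.eq]
  have h : (x * y)⁻¹ * (y * x) = y⁻¹ * x⁻¹ * y⁻¹⁻¹ * x⁻¹⁻¹ := by group
  rw [h]
  exact hIV (hcomm y⁻¹ x⁻¹)

omit [TopologicalSpace D] [IsTopologicalGroup D] [CompactSpace D] [T2Space D] in
/-- In `Multiplicative ℤ_p`: `x ^ p = 1 ⟹ x = 1` (`ℤ_p` is torsion-free). [folklore] -/
theorem eq_one_of_pow_prime_eq_one {x : Multiplicative ℤ_[p]} (hx : x ^ p = 1) : x = 1 := by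
  have h : (p : ℤ_[p]) * Multiplicative.toAdd x = 0 := by
    rw [← nsmul_eq_mul, ← toAdd_pow, hx, toAdd_one]
  rcases mul_eq_zero.mp h with h0 | h0
  · exact absurd h0 (NeZero.ne _)
  · exact Multiplicative.toAdd.injective h0

omit [TopologicalSpace D] [IsTopologicalGroup D] [CompactSpace D] [T2Space D] in
/-- If every value of `κ` is a `p`-th power of a value of `κ`, then `κ = 1` (`⋂ₙ p^n ℤ_p = 0`). [folklore] -/
theorem apply_eq_one_of_forall_exists_pow (κ : D →* Multiplicative ℤ_[p]) (h : ∀ d : D, ∃ e : D, κ d = κ e ^ p) (d : D) :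
    κ d = 1 := by
  have hn : ∀ n : ℕ, ∀ d : D, ∃ e : D, κ d = κ e ^ p ^ n := by
    intro n
    induction n with
    | zero => exact fun d ↦ ⟨d, by rw [pow_zero, pow_one]⟩
    | succ n ih =>
      intro d
      obtain ⟨e, he⟩ := ih d
      obtain ⟨e', he'⟩ := h e
      exact ⟨e', by rw [he, he', ← pow_mul, ← pow_succ']⟩
  set a : ℤ_[p] := Multiplicative.toAdd (κ d) with ha
  have hmem : ∀ n : ℕ, a ∈ Ideal.span {(p : ℤ_[p]) ^ n} := fun n ↦ by
    obtain ⟨e, he⟩ := hn n d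
    rw [ha, he, toAdd_pow, nsmul_eq_mul, Nat.cast_pow]
    exact Ideal.mem_span_singleton.mpr (dvd_mul_right _ _)
  have hnorm : ∀ n : ℕ, ‖a‖ ≤ (p : ℝ) ^ (-(n : ℤ)) := fun n ↦ (PadicInt.norm_le_pow_iff_mem_span_pow a n).mpr (hmem n)
  have ha0 : a = 0 := by
    by_contra hne
    have hpos : 0 < ‖a‖ := norm_pos_iff.mpr hne
    have hp1 : ((p : ℝ)⁻¹) < 1 := inv_lt_one_of_one_lt₀ (by exact_mod_cast hp.out.one_lt)
    have hp0 : 0 ≤ ((p : ℝ)⁻¹) := by positivity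
    obtain ⟨n, hn'⟩ := exists_pow_lt_of_lt_one hpos hp1
    have : ‖a‖ ≤ ((p : ℝ)⁻¹) ^ n := by
      rw [inv_pow, ← zpow_natCast, ← zpow_neg]
      exact hnorm n
    exact absurd (lt_of_le_of_lt this hn') (lt_irrefl _)
  rw [← ofAdd_toAdd (κ d), ← ha, ha0, ofAdd_zero]

/-- **STAGE 1: `ker κ` is pro-prime-to-`p` modulo `I`.** `D` compact Hausdorff, `I ⊴ D` closed, `φ ∈ D` with `I·⟨φ⟩` dense,
`κ : D →* ℤ_p` (multiplicative notation) continuous with `κ(I) = 1`, `κ φ ≠ 1`. Then NO subgroup `V` with `I ≤ V ≤ ker κ`, closed in `D`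
and of finite index in `ker κ`, has `p ∣ [ker κ : V]`. (Argument in the module docstring: `M_p = {e^p v}`, `D = ⋃_{k<p} φ^k M_p`, a
non-`p`-th-power class `y ∈ (ker κ)/V`, Bézout, `κ(D) = κ(D)^p`, `⋂ p^nℤ_p = 0`.) [cite: NeukirchSchmidtWingberg2008, (7.1.8) (i)] -/
theorem not_dvd_card_quotient_ker (I : Subgroup D) [I.Normal] (hI : IsClosed (I : Set D)) (φ : D)
    (hdense : Dense ((I : Set D) * (Subgroup.zpowers φ : Set D)))
    (κ : D →* Multiplicative ℤ_[p]) (hκ : Continuous κ) (hκφ : κ φ ≠ 1)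
    (V : Subgroup D) (hIV : I ≤ V) (hVN : V ≤ κ.ker) (hVc : IsClosed (V : Set D))
    [Finite (κ.ker ⧸ V.subgroupOf κ.ker)] : ¬ p ∣ Nat.card (κ.ker ⧸ V.subgroupOf κ.ker) := by
  intro hdvd
  set N := κ.ker with hNdef
  have hcomm := commutator_mem_of_dense_mul_zpowers I hI φ hdense
  haveI hVn : V.Normal := normal_of_commutator_le hcomm hIV
  -- the `p`-th powers modulo `V`: a subgroup `P ≤ D ⧸ V` (the quotient is commutative) and its preimage `Mp ≤ D`
  have hQc : ∀ a b : D ⧸ V, a * b = b * a := mk_mul_comm_of_commutator_le hcomm hIV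
  let P : Subgroup (D ⧸ V) :=
    { carrier := {q | ∃ e : D ⧸ V, e ^ p = q}
      one_mem' := ⟨1, one_pow p⟩
      mul_mem' := fun {a b} ⟨e, he⟩ ⟨f, hf⟩ ↦ ⟨e * f, by rw [(show Commute e f from hQc e f).mul_pow, he, hf]⟩
      inv_mem' := fun {a} ⟨e, he⟩ ↦ ⟨e⁻¹, by rw [inv_pow, he]⟩ }
  let Mp : Subgroup D := P.comap (QuotientGroup.mk' V)
  have hMp_mem : ∀ d : D, d ∈ Mp ↔ ∃ e v : D, v ∈ V ∧ d = e ^ p * v := by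
    intro d
    change (∃ e : D ⧸ V, e ^ p = (d : D ⧸ V)) ↔ _
    constructor
    · rintro ⟨e, he⟩
      obtain ⟨e, rfl⟩ := QuotientGroup.mk_surjective e
      rw [← QuotientGroup.mk_pow, QuotientGroup.eq] at he
      exact ⟨e, (e ^ p)⁻¹ * d, he, by group⟩
    · rintro ⟨e, v, hv, rfl⟩
      refine ⟨e, ?_⟩
      rw [← QuotientGroup.mk_pow, QuotientGroup.eq]
      simpa using hv
  have hVMp : V ≤ Mp := fun v hv ↦ (hMp_mem v).mpr ⟨1, v, hv, by rw [one_pow, one_mul]⟩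
  have hIMp : I ≤ Mp := hIV.trans hVMp
  have hpowMp : ∀ e : D, e ^ p ∈ Mp := fun e ↦ (hMp_mem _).mpr ⟨e, 1, V.one_mem, by rw [mul_one]⟩
  haveI hMpn : Mp.Normal := normal_of_commutator_le hcomm hIMp
  -- `Mp` is closed: it is the image of the compact `D × V` under `(e, v) ↦ e^p v`
  have hMpc : IsClosed (Mp : Set D) := by
    have hVcpt : IsCompact (V : Set D) := hVc.isCompact
    have himg : (Mp : Set D) = (fun q : D × D ↦ q.1 ^ p * q.2) '' (Set.univ ×ˢ (V : Set D)) := by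
      ext d
      simp only [SetLike.mem_coe, hMp_mem, Set.mem_image, Set.mem_prod, Set.mem_univ, true_and, Prod.exists]
      constructor
      · rintro ⟨e, v, hv, rfl⟩; exact ⟨e, v, hv, rfl⟩
      · rintro ⟨e, v, hv, rfl⟩; exact ⟨e, v, hv, rfl⟩
    rw [himg]
    exact ((isCompact_univ.prod hVcpt).image (by fun_prop)).isClosed
  -- density: `D = ⋃_{k<p} φ^k Mp`, i.e. every `d` is `φ^k m`
  have hcover : ∀ d : D, ∃ k : ℕ, k < p ∧ ∃ m ∈ Mp, d = φ ^ k * m := by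
    let C : Set D := ⋃ k ∈ Finset.range p, (fun m : D ↦ φ ^ k * m) '' (Mp : Set D)
    have hC : IsClosed C := by
      refine Set.Finite.isClosed_biUnion (Finset.range p).finite_toSet fun k _ ↦ ?_
      exact (Homeomorph.mulLeft (φ ^ k)).isClosedMap _ hMpc
    have hsub : (I : Set D) * (Subgroup.zpowers φ : Set D) ⊆ C := by
      rintro _ ⟨i, hi, z, hz, rfl⟩
      obtain ⟨a, rfl⟩ := Subgroup.mem_zpowers_iff.mp hz
      have hp0 : (0 : ℤ) < p := by exact_mod_cast hp.out.pos
      set k : ℤ := a % p with hk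
      set q : ℤ := a / p with hq
      have hk0 : 0 ≤ k := Int.emod_nonneg a hp0.ne'
      have hkp : k < p := Int.emod_lt_of_pos a hp0
      have ha : a = p * q + k := by rw [hk, hq, Int.emod_def]; ring
      refine Set.mem_iUnion₂.mpr ⟨k.toNat, Finset.mem_range.mpr (by omega), ?_⟩
      refine ⟨(φ ^ (k.toNat))⁻¹ * i * φ ^ (k.toNat) * (φ ^ q) ^ p, ?_, ?_⟩
      · exact Mp.mul_mem (hIMp ((inferInstance : I.Normal).conj_mem' i hi (φ ^ k.toNat))) (hpowMp _)
      · have hka : (φ ^ (k.toNat) : D) = φ ^ k := by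
          rw [← zpow_natCast, Int.toNat_of_nonneg hk0]
        rw [hka, ha, zpow_add, zpow_mul, zpow_natCast]
        group
    have hall : C = Set.univ := by
      refine Set.eq_univ_of_univ_subset ?_
      rw [← hdense.closure_eq]
      exact hC.closure_subset_iff.mpr hsub
    intro d
    have hd : d ∈ C := by rw [hall]; exact Set.mem_univ d
    obtain ⟨k, hk, m, hm, hdm⟩ := Set.mem_iUnion₂.mp hd
    exact ⟨k, Finset.mem_range.mp hk, m, hm, hdm.symm⟩
  -- (4') an element of `N ∩ Mp` is `e^p v` with `e ∈ N`
  have hNMp : ∀ n ∈ N, n ∈ Mp → ∃ e ∈ N, ∃ v ∈ V, n = e ^ p * v := by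
    intro n hn hnM
    obtain ⟨e, v, hv, rfl⟩ := (hMp_mem n).mp hnM
    refine ⟨e, ?_, v, hv, rfl⟩
    have h1 : κ (e ^ p * v) = 1 := hn
    rw [map_mul, map_pow, (hVN hv : κ v = 1), mul_one] at h1
    exact eq_one_of_pow_prime_eq_one h1
  -- Cauchy in the finite group `N/V`: the `p`-power map is not injective, hence not surjective
  let T := N ⧸ V.subgroupOf N
  obtain ⟨t, ht⟩ := exists_prime_orderOf_dvd_card' (G := T) p hdvd
  have hnotinj : ¬ Function.Injective (fun s : T ↦ s ^ p) := by
    intro hinj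
    have h1 : t ^ p = (1 : T) ^ p := by rw [← ht, pow_orderOf_eq_one, one_pow]
    have := hinj h1
    rw [this, orderOf_one] at ht
    exact hp.out.one_lt.ne' ht.symm |>.elim
  have hnotsurj : ¬ Function.Surjective (fun s : T ↦ s ^ p) := fun hs ↦
    hnotinj (Finite.injective_iff_surjective.mpr hs)
  obtain ⟨ybar, hybar⟩ : ∃ x : T, ∀ s : T, ¬ s ^ p = x := by simpa [Function.Surjective] using hnotsurj
  obtain ⟨y, rfl⟩ := QuotientGroup.mk_surjective ybar
  -- `y ∈ N ∖ Mp`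
  have hyMp : (y : D) ∉ Mp := by
    intro hyM
    obtain ⟨e, he, v, hv, hye⟩ := hNMp y y.2 hyM
    refine hybar (QuotientGroup.mk ⟨e, he⟩ : T) ?_
    rw [← QuotientGroup.mk_pow, QuotientGroup.eq, Subgroup.mem_subgroupOf, Subgroup.coe_mul, Subgroup.coe_inv,
      SubmonoidClass.coe_pow, hye, inv_mul_cancel_left]
    exact hv
  -- `y ∈ φ^k · Mp` with `0 < k < p`
  obtain ⟨k, hkp, m, hm, hyk⟩ := hcover (y : D)
  have hk0 : k ≠ 0 := by
    rintro rfl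
    rw [pow_zero, one_mul] at hyk
    exact hyMp (hyk ▸ hm)
  -- Bézout: `φ ∈ N ⊔ Mp`
  have hφk : φ ^ k ∈ N ⊔ Mp := by
    have h : φ ^ k = (y : D) * m⁻¹ := by rw [hyk, mul_inv_cancel_right]
    rw [h]
    exact Subgroup.mul_mem_sup y.2 (Mp.inv_mem hm)
  have hφp : φ ^ p ∈ N ⊔ Mp := Subgroup.mem_sup_right (hpowMp φ)
  have hφ : φ ∈ N ⊔ Mp := by
    have hcop : IsCoprime (k : ℤ) (p : ℤ) := by
      rw [Nat.isCoprime_iff_coprime, Nat.coprime_comm, hp.out.coprime_iff_not_dvd]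
      exact fun h ↦ hk0 (Nat.eq_zero_of_dvd_of_lt h hkp)
    obtain ⟨a, b, hab⟩ := hcop
    have h1 : φ = (φ ^ k) ^ a * (φ ^ p) ^ b := by
      rw [← zpow_natCast, ← zpow_natCast, ← zpow_mul, ← zpow_mul, ← zpow_add, mul_comm (k : ℤ), mul_comm (p : ℤ), hab,
        zpow_one]
    rw [h1]
    exact (N ⊔ Mp).mul_mem ((N ⊔ Mp).zpow_mem hφk a) ((N ⊔ Mp).zpow_mem hφp b)
  -- `N ⊔ Mp = ⊤`: it is closed and contains the dense `I·⟨φ⟩`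
  have hNc : IsClosed (N : Set D) := by
    rw [hNdef, MonoidHom.coe_ker]
    exact isClosed_singleton.preimage hκ
  have hsupc : IsClosed ((N ⊔ Mp : Subgroup D) : Set D) := by
    rw [Subgroup.mul_normal, ← Set.image_mul_prod]
    exact ((hNc.isCompact.prod hMpc.isCompact).image continuous_mul).isClosed
  have htop : N ⊔ Mp = ⊤ := by
    rw [eq_top_iff]
    intro d _
    have hsub : (I : Set D) * (Subgroup.zpowers φ : Set D) ⊆ ((N ⊔ Mp : Subgroup D) : Set D) := by
      rintro _ ⟨i, hi, z, hz, rfl⟩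
      exact (N ⊔ Mp).mul_mem (Subgroup.mem_sup_right (hIMp hi)) ((Subgroup.zpowers_le.mpr hφ) hz)
    have hall : ((N ⊔ Mp : Subgroup D) : Set D) = Set.univ := by
      refine Set.eq_univ_of_univ_subset ?_
      rw [← hdense.closure_eq]
      exact hsupc.closure_subset_iff.mpr hsub
    exact (show d ∈ ((N ⊔ Mp : Subgroup D) : Set D) by rw [hall]; exact Set.mem_univ d)
  -- every value of `κ` is a `p`-th power of a value of `κ`: contradiction with `κ φ ≠ 1`
  have hval : ∀ d : D, ∃ e : D, κ d = κ e ^ p := by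
    intro d
    have hd : d ∈ ((N ⊔ Mp : Subgroup D) : Set D) := htop ▸ Subgroup.mem_top d
    rw [Subgroup.mul_normal] at hd
    obtain ⟨n, hn, m, hm, rfl⟩ := hd
    obtain ⟨e, v, hv, rfl⟩ := (hMp_mem m).mp hm
    refine ⟨e, ?_⟩
    rw [map_mul, MonoidHom.mem_ker.mp hn, one_mul, map_mul, map_pow, MonoidHom.mem_ker.mp (hVN hv), mul_one]
  exact hκφ (apply_eq_one_of_forall_exists_pow κ hval φ)

end ProP

end Summit.BirchSwinnertonDyer.BirchSwinnertonDyer.Theorems.PrintCf2.JLKDescent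

end
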